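import Summits.AnomalousDissipation.AnomalousDissipation.Theses.PointSink
import Literature.Analysis.FluidPDE.SteadyNSLiouville
import Literature.Analysis.FluidPDE.SteadyDSolutionAsymptotics
import Literature.Analysis.FluidPDE.SteadyLiouvilleNineHalvesProofs

/-!
# Negative knowledge for the crux `ConeDesingularisation` (stmt-AnomalousDissipation-19034, route PointSink):
# II. Shape of a kill, and kill criterion (k2) made formal — under Liouville the crux is `¬ PointFluxCone`

Certified copy of §0 and §3 of the cdisprove work file `Cruxes/ConeDesingularisation/Disproof.lean`
(refuter-cdisprove-stmt-AnomalousDissipation-19034-0, cycle 1). Supports stmt-AnomalousDissipation-19034;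
nothing here asserts a Theses decl positively.

* §0 `crux_iff` — `ConeDesingularisation ↔ (PointFluxCone → CascadeSoliton)` (`Iff.rfl`);
  `not_crux_iff` — a refutation is EXACTLY a point-flux cone together with the non-existence of cascade
  solitons (a Liouville theorem in the critical `L²`-mass class): both conjuncts are open;
  `crux_of_cascadeSoliton`, `crux_of_not_cone` — the two degenerate ways the crux could hold.
* §3 `limit_eq_zero_of_envelope` — the `R^{5/3}` envelope pins any limit of `Q` at infinity to `0`;
  `isDSolution_of_cascade` — the soliton is a `D`-solution in the tree's sense (`IsDSolution 1 0`);
  `not_cascadeSoliton_of_liouville` — under the OPEN Liouville conjecture for steady `D`-solutions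
  (`Literature.Analysis.FluidPDE.SteadyDSolutionLiouvilleProblem`) and Galdi's Thm X.5.1 in the form of
  Wang 2025, Remark 2.1 (`wang2025_rem21_DSolution_tendsto_const`, vendored named fact p140773) there is no
  cascade soliton; hence `coneDesingularisation_iff_not_cone_of_liouville` — the crux is then EQUIVALENT to
  the failure of its own rank-2 sibling `PointFluxCone`, i.e. provable only in the situation where the
  route is already dead by kill criterion (k1). This is the planner's (k2), kernel-checked: any proof of the
  crux that does not refute `PointFluxCone` refutes the Liouville conjecture.
-/

noncomputable section

-- `Summit.<Summit>.<Problem>`: single-conjunct summit, the duplicate namespace is mandated (CONVENTIONS §2).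
set_option linter.dupNamespace false

open MeasureTheory Filter Topology Set
open Literature.Analysis.FunctionSpaces Literature.Analysis.FluidPDE

namespace Summit.AnomalousDissipation.AnomalousDissipation.Theorems.ConeDesingularisation.Negative

open Summit.AnomalousDissipation.AnomalousDissipation.Theses.PointSink
  (PointFluxCone ConeDesingularisation CascadeSoliton)

/-! ## §0 The shape of the crux and of a kill -/

/-- **The crux unfolded**: `ConeDesingularisation` is literally the implication from the rank-2 crux to
the support node `CascadeSoliton` of the same route. [folklore] -/
theorem crux_iff : ConeDesingularisation ↔ (PointFluxCone → CascadeSoliton) := Iff.rfl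

/-- **Shape of a kill**: refuting the crux means producing a point-flux cone AND proving that no cascade
soliton exists (a Liouville theorem in the critical `L²`-mass class). Both conjuncts are open problems;
this is why the crux resists cheap refutation. [folklore] -/
theorem not_crux_iff : ¬ ConeDesingularisation ↔ (PointFluxCone ∧ ¬ CascadeSoliton) := by
  rw [crux_iff, Classical.not_imp]

/-- Degenerate way 1: a cascade soliton proved outright (support item stmt-AnomalousDissipation-19036)
makes the crux trivially true (hypothesis unused). [folklore] -/
theorem crux_of_cascadeSoliton (h : CascadeSoliton) : ConeDesingularisation := fun _ => h

/-- Degenerate way 2 (VACUITY): if the rank-2 crux `PointFluxCone` is false the crux holds vacuously —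
and the route is dead by its kill criterion (k1). [folklore] -/
theorem crux_of_not_cone (h : ¬ PointFluxCone) : ConeDesingularisation := fun hc => absurd hc h

/-! ## §3 Kill criterion (k2), formal: under Liouville the conclusion is empty -/

/-- **The `R^{5/3}` envelope pins the limit at infinity to `0`.** If a continuous field with the
`L²`-mass envelope `∫_{B_R} ‖Q‖² ≤ C R^{5/3}` (`R ≥ 1`) converges to a constant vector `u₀` at infinity
(`cocompact`), then `u₀ = 0`: otherwise `‖Q‖ ≥ ‖u₀‖/2` outside a ball `B_{R₀}` and
`∫_{B_R}‖Q‖² ≥ (‖u₀‖/2)² (R³|B_1| − |B̄_{R₀}|) ≫ C R^{5/3}`. This is the step that lets a user holding only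
the envelope (not `Q ∈ L⁶`) feed a pointwise-decay Liouville theorem. [folklore] -/
theorem limit_eq_zero_of_envelope {Q : EuclideanSpace ℝ (Fin 3) → EuclideanSpace ℝ (Fin 3)} (hQ : Continuous Q) {C : ℝ}
    (hC : ∀ R : ℝ, 1 ≤ R → ∫ x in Metric.ball (0 : EuclideanSpace ℝ (Fin 3)) R, ‖Q x‖ ^ 2 ≤ C * R ^ (5 / 3 : ℝ))
    {u₀ : EuclideanSpace ℝ (Fin 3)} (hlim : Tendsto Q (cocompact (EuclideanSpace ℝ (Fin 3))) (𝓝 u₀)) : u₀ = 0 := by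
  by_contra hu
  set a : ℝ := ‖u₀‖ with ha
  have ha0 : 0 < a := norm_pos_iff.2 hu
  -- far out, `‖Q x‖ ≥ a/2`
  have hev : ∀ᶠ x in cocompact (EuclideanSpace ℝ (Fin 3)), dist (Q x) u₀ < a / 2 :=
    Metric.tendsto_nhds.1 hlim (a / 2) (by linarith)
  obtain ⟨t, ht, hts⟩ := mem_cocompact.1 hev
  obtain ⟨R₀, hR₀⟩ := (ht.isBounded).subset_closedBall (0 : EuclideanSpace ℝ (Fin 3))
  have hfar : ∀ x : EuclideanSpace ℝ (Fin 3), R₀ < ‖x‖ → a / 2 ≤ ‖Q x‖ := by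
    intro x hx
    have hxt : x ∉ t := by
      intro hxt
      have := hR₀ hxt
      rw [Metric.mem_closedBall, dist_zero_right] at this
      linarith
    have h1 : dist (Q x) u₀ < a / 2 := hts hxt
    rw [dist_eq_norm] at h1
    have h2 : ‖u₀‖ - ‖Q x‖ ≤ ‖Q x - u₀‖ := by
      have := norm_sub_norm_le u₀ (Q x)
      rwa [norm_sub_rev] at this
    linarith
  -- volumes
  set v₁ : ℝ := volume.real (Metric.ball (0 : EuclideanSpace ℝ (Fin 3)) 1) with hv₁
  have hv₁pos : 0 < v₁ :=
    ENNReal.toReal_pos (Metric.measure_ball_pos volume (0 : EuclideanSpace ℝ (Fin 3)) one_pos).ne'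
      (measure_ball_lt_top).ne
  have hballvol : ∀ R : ℝ, 0 < R →
      volume.real (Metric.ball (0 : EuclideanSpace ℝ (Fin 3)) R) = R ^ 3 * v₁ := by
    intro R hR
    simp only [hv₁, measureReal_def]
    rw [Measure.addHaar_ball_of_pos volume (0 : EuclideanSpace ℝ (Fin 3)) hR, ENNReal.toReal_mul,
      ENNReal.toReal_ofReal (pow_nonneg hR.le _), finrank_euclideanSpace_fin]
  set K : ℝ := volume.real (Metric.closedBall (0 : EuclideanSpace ℝ (Fin 3)) R₀) with hK
  have hK0 : 0 ≤ K := measureReal_nonneg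
  -- lower bound on balls: (R³ v₁ - K) (a/2)² ≤ C R^{5/3} for R ≥ max 1 R₀
  have key : ∀ R : ℝ, 1 ≤ R → R₀ ≤ R → (R ^ 3 * v₁ - K) * (a / 2) ^ 2 ≤ C * R ^ (5 / 3 : ℝ) := by
    intro R hR1 hR0
    have hRpos : 0 < R := by linarith
    set D : Set (EuclideanSpace ℝ (Fin 3)) := Metric.ball (0 : EuclideanSpace ℝ (Fin 3)) R \ Metric.closedBall (0 : EuclideanSpace ℝ (Fin 3)) R₀ with hD
    have hDm : MeasurableSet D := measurableSet_ball.diff measurableSet_closedBall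
    have hDsub : D ⊆ Metric.ball (0 : EuclideanSpace ℝ (Fin 3)) R := Set.sdiff_subset
    have hDfin : volume D ≠ ⊤ := measure_ne_top_of_subset hDsub measure_ball_lt_top.ne
    have iQ : IntegrableOn (fun x => ‖Q x‖ ^ 2) (Metric.ball (0 : EuclideanSpace ℝ (Fin 3)) R) volume :=
      (((hQ.norm.pow 2).continuousOn).integrableOn_compact (isCompact_closedBall (0 : EuclideanSpace ℝ (Fin 3)) R)).mono_set
        Metric.ball_subset_closedBall
    have h1 : ∫ x in D, ‖Q x‖ ^ 2 ≤ ∫ x in Metric.ball (0 : EuclideanSpace ℝ (Fin 3)) R, ‖Q x‖ ^ 2 :=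
      setIntegral_mono_set iQ (ae_of_all _ fun x => sq_nonneg _) (ae_of_all _ hDsub)
    have h2 : ∫ x in D, (a / 2) ^ 2 ≤ ∫ x in D, ‖Q x‖ ^ 2 := by
      refine setIntegral_mono_on (integrableOn_const hDfin) (iQ.mono_set hDsub) hDm fun x hx => ?_
      have hxR₀ : R₀ < ‖x‖ := by
        have := hx.2
        rw [Metric.mem_closedBall, dist_zero_right, not_le] at this
        exact this
      exact pow_le_pow_left₀ (by linarith) (hfar x hxR₀) 2
    have h3 : ∫ x in D, (a / 2) ^ 2 = volume.real D * (a / 2) ^ 2 := by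
      rw [setIntegral_const, smul_eq_mul]
    have h4 : R ^ 3 * v₁ - K ≤ volume.real D := by
      have := le_measureReal_sdiff (μ := volume) (s₁ := Metric.ball (0 : EuclideanSpace ℝ (Fin 3)) R)
        (s₂ := Metric.closedBall (0 : EuclideanSpace ℝ (Fin 3)) R₀) measure_closedBall_lt_top.ne
      rwa [hballvol R hRpos] at this
    have h5 : (R ^ 3 * v₁ - K) * (a / 2) ^ 2 ≤ volume.real D * (a / 2) ^ 2 :=
      mul_le_mul_of_nonneg_right h4 (sq_nonneg _)
    linarith [hC R hR1]
  -- growth contradiction: R^{5/3} ≤ R², so R v₁ (a/2)² ≤ |C| + K (a/2)² for all large R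
  have key2 : ∀ R : ℝ, 1 ≤ R → R₀ ≤ R → R * (v₁ * (a / 2) ^ 2) ≤ |C| + K * (a / 2) ^ 2 := by
    intro R hR1 hR0
    have hRpos : 0 < R := by linarith
    have h53 : R ^ (5 / 3 : ℝ) ≤ R ^ (2 : ℝ) := Real.rpow_le_rpow_of_exponent_le hR1 (by norm_num)
    rw [Real.rpow_two] at h53
    have h1 := key R hR1 hR0
    have h2a : C * R ^ (5 / 3 : ℝ) ≤ |C| * R ^ (5 / 3 : ℝ) :=
      mul_le_mul_of_nonneg_right (le_abs_self C) (Real.rpow_nonneg hRpos.le _)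
    have h2b : |C| * R ^ (5 / 3 : ℝ) ≤ |C| * R ^ 2 := mul_le_mul_of_nonneg_left h53 (abs_nonneg C)
    have h3 : (R ^ 3 * v₁ - K) * (a / 2) ^ 2 ≤ |C| * R ^ 2 := h1.trans (h2a.trans h2b)
    have hR2 : (1 : ℝ) ≤ R ^ 2 := one_le_pow₀ hR1
    have hR2pos : (0 : ℝ) < R ^ 2 := by positivity
    have ha2 : 0 ≤ (a / 2) ^ 2 := sq_nonneg _
    have h4 : R * (v₁ * (a / 2) ^ 2) * R ^ 2 ≤ (|C| + K * (a / 2) ^ 2) * R ^ 2 := by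
      nlinarith [mul_nonneg hK0 ha2, abs_nonneg C]
    exact le_of_mul_le_mul_right h4 hR2pos
  set M : ℝ := |C| + K * (a / 2) ^ 2 with hM
  set w : ℝ := v₁ * (a / 2) ^ 2 with hw
  have hwpos : 0 < w := mul_pos hv₁pos (by positivity)
  set R : ℝ := max (max 1 R₀) (M / w + 1) with hR
  have hR1 : 1 ≤ R := (le_max_left _ _).trans (le_max_left _ _)
  have hR0 : R₀ ≤ R := (le_max_right _ _).trans (le_max_left _ _)
  have hRM : M / w + 1 ≤ R := le_max_right _ _
  have h1 := key2 R hR1 hR0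
  have h2 : (M / w + 1) * w ≤ R * w := mul_le_mul_of_nonneg_right hRM hwpos.le
  rw [add_mul, div_mul_cancel₀ _ hwpos.ne', one_mul] at h2
  linarith

/-- **The soliton is a `D`-solution** in the tree's sense: a steady classical unforced unit-viscosity
solution on the time set `univ` with `∫ |∇Q|² < ∞` is `IsDSolution 1 0 Q P` (momentum rearranged via the
Leray-profile bridge; `Integrable ⇒ ∫⁻ ofReal < ∞`). [folklore] -/
theorem isDSolution_of_cascade {Q : EuclideanSpace ℝ (Fin 3) → EuclideanSpace ℝ (Fin 3)} {P : EuclideanSpace ℝ (Fin 3) → ℝ}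
    (h : IsClassicalNSSolutionOn (univ : Set ℝ) 1 (fun _ _ => 0) (fun _ => Q) (fun _ => P))
    (hInt : Integrable (fun x => frobeniusNormSq (fderiv ℝ Q x))) : IsDSolution 1 0 Q P := by
  have hprof := h.isLerayProfile_zero_of_steady
  refine ⟨?_, hInt.lintegral_lt_top⟩
  exact
    { contDiff_velocity := hprof.contDiff_velocity
      contDiff_pressure := hprof.contDiff_pressure
      momentum := fun y => by
        have := hprof.profile_eq y
        simp only [zero_smul, add_zero] at this
        simpa using this
      divFree := hprof.divFree }

/-- **Kill criterion (k2), formal: under Liouville there is no cascade soliton.** Assume the OPEN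
Liouville conjecture for steady `D`-solutions on `ℝ³` (`SteadyDSolutionLiouvilleProblem`: smooth, finite
Dirichlet integral, `u → 0` pointwise ⇒ `u ≡ 0`) and Galdi's Thm X.5.1 in the form of Wang 2025,
Remark 2.1 (`wang2025_rem21_DSolution_tendsto_const`: every `D`-solution tends to SOME constant at
infinity). Then the conclusion of the crux is empty: the soliton is a `D`-solution, tends to a constant,
the `R^{5/3}` envelope forces that constant to be `0`, Liouville gives `Q ≡ 0`, contradicting
`0 < ∫ |∇Q|²`. [folklore] -/
theorem not_cascadeSoliton_of_liouville (hL : SteadyDSolutionLiouvilleProblem)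
    (hrem : wang2025_rem21_DSolution_tendsto_const) : ¬ CascadeSoliton := by
  rintro ⟨Q, P, hNS, ⟨C, hC⟩, hInt, hpos, -⟩
  have hprof : IsLerayProfile 1 0 Q P := hNS.isLerayProfile_zero_of_steady
  have hD : IsDSolution 1 0 Q P := isDSolution_of_cascade hNS hInt
  obtain ⟨u₀, hu₀⟩ := hrem Q P hD
  have hQs : ContDiff ℝ (⊤ : ℕ∞) Q := hNS.contDiff_velocity (mem_univ (0 : ℝ))
  have hPs : ContDiff ℝ (⊤ : ℕ∞) P := hNS.contDiff_pressure (mem_univ (0 : ℝ))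
  have hu0 : u₀ = 0 := limit_eq_zero_of_envelope hQs.continuous hC hu₀
  subst hu0
  have hQ0 : Q = 0 := hL Q P hprof hQs hPs hD.2 hu₀
  subst hQ0
  simp [frobeniusNormSq_zero] at hpos

/-- **Under Liouville the crux is `¬ PointFluxCone`.** With the two hypotheses of
`not_cascadeSoliton_of_liouville`, `ConeDesingularisation` holds iff its own rank-2 sibling `PointFluxCone`
fails. Information for allocation: every proof of the crux either refutes the cone (and the route dies by
(k1)) or refutes the Liouville conjecture for steady `D`-solutions. [folklore] -/
theorem coneDesingularisation_iff_not_cone_of_liouville (hL : SteadyDSolutionLiouvilleProblem)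
    (hrem : wang2025_rem21_DSolution_tendsto_const) : ConeDesingularisation ↔ ¬ PointFluxCone :=
  ⟨fun h hc => not_cascadeSoliton_of_liouville hL hrem (h hc), fun h hc => absurd hc h⟩

end Summit.AnomalousDissipation.AnomalousDissipation.Theorems.ConeDesingularisation.Negative

end
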